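import Summits.BirchSwinnertonDyer.BirchSwinnertonDyer.Theorems.AdditiveKolyvaginRoadLevelKolyvaginSystemsAdditiveOfSeedOfTwin
import Summits.BirchSwinnertonDyer.BirchSwinnertonDyer.Theorems.AdditiveKolyvaginRoadLevelKolyvaginSystemsAdditiveGammaLocusKPA
import Summits.BirchSwinnertonDyer.BirchSwinnertonDyer.Theorems.AdditiveKolyvaginRoadLevelSystemsOfSeedAtFrame
import Summits.BirchSwinnertonDyer.BirchSwinnertonDyer.Theorems.AdditiveKolyvaginRoadSignAgreementOfTorsionCongr
import HarnessLib

/-!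
# Route `AdditiveKolyvaginRoad`, crux KS′ `LevelKolyvaginSystemsAdditive` (item stmt-BirchSwinnertonDyer-21396):
# KS′ FROM KPA′ — the route's crux r8 from its crux r2, PUB, DUAL and the TWIN DICHOTOMY (the crux-triage reading (α) in the kernel),
# and KS′ on the GOOD-AVATAR LOCUS of line `epsilon_matched_retyping` WITHOUT W. Zhang's displayed bipartite datum
# (cell `pub/bsd-wall`, width seat `bsd-wall-akr-p2x-w2` g6; `--supports stmt-BirchSwinnertonDyer-21396`, helper; corollaries of this seat's
# `nonempty_levelKolyvaginSystemP_of_seed_of_twin`, p625738)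

WHY. Skeleton v9 of line `epsilon_matched_retyping` (lead cruxlead-21396-g0 a0) left crux KS′ as: S1′ `stub_offGoodAvatarDatumLocus` (KS′ off the
good-avatar-WITH-DATUM locus — crux-sized) + S0 (six refereed facts); its on-locus branch `levelKolyvaginSystemsAdditive_onGoodAvatarDatumLocus`
(p619074) needs, per frame and per complex conjugation, a DISPLAYED W. Zhang level-raised bipartite datum for the avatar `E₀` — in print only for
ORDINARY avatars (`WZhang2014.exists_levelRaisedBipartiteSystem`, XL, no `_holds`), for nobody on the (5, II*) single-slope sub-cell (supersingular
avatars; SS-AVATAR-WIDENING-AUDIT). The crux-triage finding (TRIAGE-r1-1 v17 §1–§2) is that the datum is bookkeeping: the carrier is inhabited by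
canonical lines from ONE seed. This seat typed that: engine (p624045, p624937) and E-side `nonempty_levelKolyvaginSystemP_of_seed_of_twin` (p625738:
KS′-fibre ⟸ seed ∧ Poitou–Tate ∧ odd bottom rank ∧ (Twin)). THIS FILE draws the two consequences:
* §2 `levelKolyvaginSystemsAdditive_of_kolyvaginPrimitive_of_twin` — ROUTE LEVEL: `PUB → DUAL → (Twin) → KolyvaginPrimitiveAdditive →
  LevelKolyvaginSystemsAdditive` (KPA′ supplies the seed at every ♯ frame; odd bottom rank by `odd_finrank_selQP_empty_of_published`; Poitou–Tate =
  DUAL.2). With the tree's `kolyvaginPrimitiveOfLevelSystemsAdditive_proof : PUB → DUAL → KS′ → BOT′ → KPA′` the cruxes r2 and r8 are ONE statement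
  modulo PUB ∕ DUAL ∕ BOT′ ∕ (Twin).
* §3 `levelKolyvaginSystemsAdditive_onGoodAvatarLocus_of_twin` — ON THE GOOD-AVATAR LOCUS (v9's locus with the datum clause, `N₀p² = N`, `htam₀`,
  the root-number and `hs₀` clauses REMOVED): KS′'s fibre ⟸ Kriz–Li Thm. 1.16 + PUB + DUAL + (Twin), the seed being
  `kolyvaginPrimitiveAdditive_conclusion_on_gammaLocus` (w3 g6 ∕ lead: conductor-one class of `E` non-zero mod `p` by the log congruence) and the level
  system being E's OWN canonical lines — no lender, no (Tam), no (θK)ₚ. So the (5, II*) single-slope sub-cell (supersingular good avatars) and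
  every good-avatar frame are covered MODULO (Twin), and Zhang's XL fact leaves the line.
(§1 `exists_finset_prod_eq_of_kolySupp`-type bookkeeping: a `KolSupp` conductor is the product of the finite set of its prime factors.)

(Twin) — the ONE displayed E-side input, quantified over all frames (`p ≥ 5`, `ρ̄` onto, `K` imaginary quadratic with `d_K < −4`, `c ≠ 1`,
Poitou–Tate) and over the mixed spaces through their membership dictionary: Howard 2004 Lemma 2.5.3 for the structures «Kummer off `m ∪ n`, toric on
`n`, transverse on `m`» at a Kolyvagin prime `ℓ ∉ m`, non-empty level `n`, each sign — `hDrop` (PT-free: REC + `perf` + `line`), `hRise` + `hJump`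
(`hjump_of_poitouTateP` + the local trichotomy «an isotropic eigenclass at `λ` is Kummer or transverse»). Not in the tree yet; the re-line's stub.

HONEST FRAMING: theorems only; 0 definitions, 0 named facts, 0 `sorry`; CONDITIONAL on (Twin) (hypothesis), on KPA′ (§2) ∕ Kriz–Li (§3) and the
published bundles BY NAME. Closes nothing: KS′ quantifies over ALL ♯ frames. BSD is not proved by any of this; KS′, KPA′ are OPEN.

References: [cite: Howard2004HeegnerKolyvagin, Lemma 2.5.3, Lemma 2.6.4] [cite: KrizLi2019, Thm. 1.16, Rem. 1.17] [cite: WZhang2014, Thm. 4.3,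
Thm. 7.2, §8.1, §9] [cite: McCallumLMS1991, Cor. 3.2] [cite: GrossLMS1991, §4 (4.4)].
-/

set_option linter.dupNamespace false -- single-conjunct summit repeats the name by design

noncomputable section

open scoped Classical

namespace Summit.BirchSwinnertonDyer.BirchSwinnertonDyer.Theorems.AdditiveKoly

open WeierstrassCurve NumberField IsDedekindDomain Field
  Literature.NumberTheory.EllipticCurves Literature.NumberTheory.EllipticCurves.ModularForms
  Literature.NumberTheory.EllipticCurves.Rank1Residual Literature.NumberTheory.GaloisRepresentations Module
  Summit.BirchSwinnertonDyer.Rank1Residual.X11b.Three.Koly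
  Summit.BirchSwinnertonDyer.BirchSwinnertonDyer.Theses.AdditiveKolyvaginRoad
  Summit.BirchSwinnertonDyer.Rank1Residual

/-! ## §1 Bookkeeping: a square-free product of Kolyvagin primes is the product of a finite set of them -/

/-- A `KolSupp` conductor `n` (square-free, every prime factor in `Kol`) is `∏ m` for a finite set `m` of primes in `Kol` (the set
of its prime factors). [folklore] -/
theorem exists_finset_prod_eq_of_kolSupp {Kol : ℕ → Prop} {n : ℕ} (h : KolyvaginDescent.KolSupp Kol n) :
    ∃ m : Finset {ℓ // Kol ℓ}, (∏ ℓ ∈ m, (ℓ : ℕ)) = n := by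
  refine ⟨n.primeFactors.subtype Kol, ?_⟩
  rw [Finset.prod_subtype_eq_prod_filter (f := fun ℓ : ℕ ↦ ℓ)]
  rw [Finset.filter_true_of_mem (fun q hq ↦ h.2 q hq)]
  exact Nat.prod_primeFactors_of_squarefree h.1

/-! ## §2 ROUTE LEVEL: crux r8 KS′ from crux r2 KPA′, the published inputs and the twin dichotomy -/

/-- **KS′ ⟸ KPA′ + PUB + DUAL + (Twin)** — crux r8 `LevelKolyvaginSystemsAdditive` of route `AdditiveKolyvaginRoad` from crux r2
`KolyvaginPrimitiveAdditive` (BY NAME), the route's displayed bundles `PublishedInputsAdditiveKoly` (for the odd bottom rank: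
Gross–Zagier + Kolyvagin + Cassels–Tate, tree `odd_finrank_selQP_empty_of_published`) and `PublishedDualityInputsAdditiveKoly` (Poitou–Tate for
Selmer structures over `K`), and the TWIN DICHOTOMY for the mixed Selmer spaces at every ♯-type frame (Howard 2004 Lemma 2.5.3; displayed,
HYPOTHESIS). The kernel form of the crux-triage reading (α) «KS′ ≡ KPA′ modulo E-side bookkeeping» (TRIAGE-r1-1 v17 §1–§2): at each ♯
additive frame KPA′ supplies the seed and `nonempty_levelKolyvaginSystemP_of_seed_of_twin` the level system. With the tree's converse
`kolyvaginPrimitiveOfLevelSystemsAdditive_proof : PUB → DUAL → KS′ → BOT′ → KPA′` the two cruxes are one statement modulo PUB ∕ DUAL ∕ BOT′ ∕ (Twin).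
CONDITIONAL; closes nothing (KPA′ is open). [cite: Howard2004HeegnerKolyvagin, Lemma 2.5.3] [cite: WZhang2014, §9] [cite: McCallumLMS1991, Cor. 3.2] -/
theorem levelKolyvaginSystemsAdditive_of_kolyvaginPrimitive_of_twin (hPUB : PublishedInputsAdditiveKoly)
    (hDual : PublishedDualityInputsAdditiveKoly)
    (hTwin : (∀ (W : WeierstrassCurve ℚ) [W.IsElliptic] [W.IsGloballyMinimal] [NeZero (W.conductorNorm ℤ)] (p : ℕ) [Fact p.Prime]
      (K : Type) [Field K] [NumberField K] (c : K ≃ₐ[ℚ] K) (ι : K →+* ℂ),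
      5 ≤ p → W.HasSurjectiveModNGaloisRep p → IsImaginaryQuadratic K → NumberField.discr K < -4 → c ≠ 1 →
      Literature.NumberTheory.GaloisCohomology.poitouTate_selmerStructure_duality K →
      ∀ [Module (ZMod p) (Vp W K p)] (Mix : Finset {ℓ // Zhang2014.IsKolyvaginPrime (W.conductorNorm ℤ) W K p ℓ} → Finset (AdmQ W K p) → Bool → Submodule (ZMod p) (Vp W K p)),
      (∀ (m : Finset {ℓ // Zhang2014.IsKolyvaginPrime (W.conductorNorm ℤ) W K p ℓ}) (n : Finset (AdmQ W K p)) (μ : Bool) (x : Vp W K p),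
        x ∈ Mix m n μ ↔ (conjAct W c ((p ^ 1 : ℕ) : ℤ) x = sgnP μ • x ∧
          (∀ w : InfinitePlace K, x ∈ selmerLocalKer (W.baseChange K) w.Completion ((p ^ 1 : ℕ) : ℤ)) ∧
          (∀ v : HeightOneSpectrum (𝓞 K), (∀ ℓ ∈ m, ((ℓ : ℕ) : 𝓞 K) ∉ v.asIdeal) → (∀ q ∈ n, ((q : ℕ) : 𝓞 K) ∉ v.asIdeal) →
            x ∈ selmerLocalKer (W.baseChange K) (v.adicCompletion K) ((p ^ 1 : ℕ) : ℤ)) ∧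
          (∀ q ∈ n, ∀ v : HeightOneSpectrum (𝓞 K), ((q : ℕ) : 𝓞 K) ∈ v.asIdeal →
            x ∈ toricLocalKer (W.baseChange K) (v.adicCompletion K) ((p ^ 1 : ℕ) : ℤ)) ∧
          (∀ ℓ ∈ m, ∀ v : HeightOneSpectrum (𝓞 K), ((ℓ : ℕ) : 𝓞 K) ∈ v.asIdeal → x ∈ transverseLocalKerP W K p ι ℓ v))) →
      (∀ (m : Finset {ℓ // Zhang2014.IsKolyvaginPrime (W.conductorNorm ℤ) W K p ℓ}) (n : Finset (AdmQ W K p)) (μ : Bool), Module.Finite (ZMod p) (Mix m n μ)) →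
      (∀ (m : Finset {ℓ // Zhang2014.IsKolyvaginPrime (W.conductorNorm ℤ) W K p ℓ}) (ℓ : {ℓ // Zhang2014.IsKolyvaginPrime (W.conductorNorm ℤ) W K p ℓ}) (n : Finset (AdmQ W K p)) (μ : Bool), ℓ ∉ m → n.Nonempty →
        (∃ x ∈ Mix m n μ, ¬ (∀ v : HeightOneSpectrum (𝓞 K), ((ℓ : ℕ) : 𝓞 K) ∈ v.asIdeal → x ∈ (W.baseChange K).torsionLocalKer (v.adicCompletion K) ((p ^ 1 : ℕ) : ℤ))) →
        (∀ y, y ∈ Mix (insert ℓ m) n μ ↔ (y ∈ Mix m n μ ∧ (∀ v : HeightOneSpectrum (𝓞 K), ((ℓ : ℕ) : 𝓞 K) ∈ v.asIdeal → y ∈ (W.baseChange K).torsionLocalKer (v.adicCompletion K) ((p ^ 1 : ℕ) : ℤ)))) ∧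
          finrank (ZMod p) (Mix (insert ℓ m) n μ) + 1 = finrank (ZMod p) (Mix m n μ)) ∧
      (∀ (m : Finset {ℓ // Zhang2014.IsKolyvaginPrime (W.conductorNorm ℤ) W K p ℓ}) (ℓ : {ℓ // Zhang2014.IsKolyvaginPrime (W.conductorNorm ℤ) W K p ℓ}) (n : Finset (AdmQ W K p)) (μ : Bool), ℓ ∉ m → n.Nonempty →
        (∃ y ∈ Mix (insert ℓ m) n μ, ¬ (∀ v : HeightOneSpectrum (𝓞 K), ((ℓ : ℕ) : 𝓞 K) ∈ v.asIdeal → y ∈ (W.baseChange K).torsionLocalKer (v.adicCompletion K) ((p ^ 1 : ℕ) : ℤ))) →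
        (∀ x, x ∈ Mix m n μ ↔ (x ∈ Mix (insert ℓ m) n μ ∧ (∀ v : HeightOneSpectrum (𝓞 K), ((ℓ : ℕ) : 𝓞 K) ∈ v.asIdeal → x ∈ (W.baseChange K).torsionLocalKer (v.adicCompletion K) ((p ^ 1 : ℕ) : ℤ)))) ∧
          finrank (ZMod p) (Mix m n μ) + 1 = finrank (ZMod p) (Mix (insert ℓ m) n μ)) ∧
      (∀ (m : Finset {ℓ // Zhang2014.IsKolyvaginPrime (W.conductorNorm ℤ) W K p ℓ}) (ℓ : {ℓ // Zhang2014.IsKolyvaginPrime (W.conductorNorm ℤ) W K p ℓ}) (n : Finset (AdmQ W K p)) (μ : Bool), ℓ ∉ m → n.Nonempty →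
        (∃ x ∈ Mix m n μ, ¬ (∀ v : HeightOneSpectrum (𝓞 K), ((ℓ : ℕ) : 𝓞 K) ∈ v.asIdeal → x ∈ (W.baseChange K).torsionLocalKer (v.adicCompletion K) ((p ^ 1 : ℕ) : ℤ))) ∨ (∃ y ∈ Mix (insert ℓ m) n μ, ¬ (∀ v : HeightOneSpectrum (𝓞 K), ((ℓ : ℕ) : 𝓞 K) ∈ v.asIdeal → y ∈ (W.baseChange K).torsionLocalKer (v.adicCompletion K) ((p ^ 1 : ℕ) : ℤ))))))
    (hKPA : KolyvaginPrimitiveAdditive) : LevelKolyvaginSystemsAdditive := by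
  intro W _ _ _ p _ K _ _ Dt β ι hp5 hadd hs hsp htwo htam hr hK hodd hlt hH hL hβ hc c hc1 _
  -- the seed: KPA′ at the frame, re-indexed by a finite set of Kolyvagin primes
  obtain ⟨n, d, hsupp, hd⟩ := hKPA W p K Dt β ι hp5 hadd hs hsp htwo htam hr hK hodd hlt hH hL hβ hc
  obtain ⟨m, hm⟩ := exists_finset_prod_eq_of_kolSupp hsupp
  have seed : ∃ (m : Finset {ℓ // Zhang2014.IsKolyvaginPrime (W.conductorNorm ℤ) W K p ℓ}) (d : KolyvaginHeegnerData Dt β ι (∏ ℓ ∈ m, (ℓ : ℕ))),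
      d.kolyvaginClass (Fact.out : p.Prime) 1 ≠ 0 := ⟨m, by rw [hm]; exact ⟨d, hd⟩⟩
  -- the mixed spaces and the twin dichotomy for them
  obtain ⟨Mix, hMix, hfin⟩ := exists_mixedSpaces W K p c ι
  obtain ⟨hDrop, hRise, hJump⟩ := hTwin W p K c ι hp5 hs hK hlt hc1 (hDual.2 K) Mix hMix hfin
  exact nonempty_levelKolyvaginSystemP_of_seed_of_twin W K p c ι Dt β hK hp5 hs hc1 hH hβ (hDual.2 K)
    (odd_finrank_selQP_empty_of_published W K p c Dt β ι hPUB hDual hp5 hadd hs hsp htwo htam hr hK hodd hH hL hβ hc)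
    Mix hMix hfin hDrop hRise hJump seed

/-! ## §3 ON THE GOOD-AVATAR LOCUS: KS′'s fibre WITHOUT the displayed Zhang datum, modulo the twin dichotomy -/

/-- **KS′ ON THE GOOD-AVATAR LOCUS, DATUM-FREE, modulo (Twin).** Frame: a ♯ rank-one additive frame of the route (`p ≥ 5`, `Addv`, `ρ̄` onto,
♠(1), ♠(2), `p ∤ ∏c`, `r_an = 1`, `K` imaginary quadratic with `d_K` odd `< −4`, Heegner for `N_E`, `L(E^{d_K}, 1) ≠ 0`, `4N ∣ β² − d_K`,
`p ∤ c(Dt)`). Locus: a GOOD (ordinary or supersingular) NON-ANOMALOUS avatar `E₀ = W₀` (`Γ_ℚ`-iso `E[p] ≃ E₀[p]`, ♠(1) for `E₀`, `rad(pN) = rad(pN₀)`,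
same multiplicative primes, Heegner for `N₀`, a parametrisation `Dt₀` with `p ∤ c(Dt₀)`) carrying the LOG CERTIFICATE «some Heegner point `y₀ ∈ E₀(K)`
over `heegnerPointComplex Dt₀ H₀` is not `p`-divisible in `E₀(ℚ_p)`». Compared with the landed `levelKolyvaginSystemsAdditive_onGoodAvatarDatumLocus`
(p619074, skeleton v9's on-locus branch) the locus has NO displayed W. Zhang bipartite datum (and no `N₀p² = N`, `htam₀`, root-number or `hs₀`
clause): the seed is Kriz–Li's (`kolyvaginPrimitiveAdditive_conclusion_on_gammaLocus`, w3 g6 ∕ lead), the odd bottom rank is PUB + Cassels–Tate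
(`odd_finrank_selQP_empty_of_published`), Poitou–Tate is DUAL.2, and the level system is `nonempty_levelKolyvaginSystemP_of_seed_of_twin` — for
`E` ITSELF (no lender). INPUTS BY NAME: Kriz–Li Thm. 1.16, PUB, DUAL; DISPLAYED: (Twin). CONCLUSION: KS′'s fibre at the frame. CONDITIONAL on
(Twin); closes nothing. [cite: KrizLi2019, Thm. 1.16] [cite: Howard2004HeegnerKolyvagin, Lemma 2.5.3] [cite: WZhang2014, §9] -/
theorem levelKolyvaginSystemsAdditive_onGoodAvatarLocus_of_twin (hKL : KrizLi2019.thm116_padicLogHeegner_congruence)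
    (hPUB : PublishedInputsAdditiveKoly) (hDual : PublishedDualityInputsAdditiveKoly)
    (hTwin : (∀ (W : WeierstrassCurve ℚ) [W.IsElliptic] [W.IsGloballyMinimal] [NeZero (W.conductorNorm ℤ)] (p : ℕ) [Fact p.Prime]
      (K : Type) [Field K] [NumberField K] (c : K ≃ₐ[ℚ] K) (ι : K →+* ℂ),
      5 ≤ p → W.HasSurjectiveModNGaloisRep p → IsImaginaryQuadratic K → NumberField.discr K < -4 → c ≠ 1 →
      Literature.NumberTheory.GaloisCohomology.poitouTate_selmerStructure_duality K →
      ∀ [Module (ZMod p) (Vp W K p)] (Mix : Finset {ℓ // Zhang2014.IsKolyvaginPrime (W.conductorNorm ℤ) W K p ℓ} → Finset (AdmQ W K p) → Bool → Submodule (ZMod p) (Vp W K p)),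
      (∀ (m : Finset {ℓ // Zhang2014.IsKolyvaginPrime (W.conductorNorm ℤ) W K p ℓ}) (n : Finset (AdmQ W K p)) (μ : Bool) (x : Vp W K p),
        x ∈ Mix m n μ ↔ (conjAct W c ((p ^ 1 : ℕ) : ℤ) x = sgnP μ • x ∧
          (∀ w : InfinitePlace K, x ∈ selmerLocalKer (W.baseChange K) w.Completion ((p ^ 1 : ℕ) : ℤ)) ∧
          (∀ v : HeightOneSpectrum (𝓞 K), (∀ ℓ ∈ m, ((ℓ : ℕ) : 𝓞 K) ∉ v.asIdeal) → (∀ q ∈ n, ((q : ℕ) : 𝓞 K) ∉ v.asIdeal) →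
            x ∈ selmerLocalKer (W.baseChange K) (v.adicCompletion K) ((p ^ 1 : ℕ) : ℤ)) ∧
          (∀ q ∈ n, ∀ v : HeightOneSpectrum (𝓞 K), ((q : ℕ) : 𝓞 K) ∈ v.asIdeal →
            x ∈ toricLocalKer (W.baseChange K) (v.adicCompletion K) ((p ^ 1 : ℕ) : ℤ)) ∧
          (∀ ℓ ∈ m, ∀ v : HeightOneSpectrum (𝓞 K), ((ℓ : ℕ) : 𝓞 K) ∈ v.asIdeal → x ∈ transverseLocalKerP W K p ι ℓ v))) →
      (∀ (m : Finset {ℓ // Zhang2014.IsKolyvaginPrime (W.conductorNorm ℤ) W K p ℓ}) (n : Finset (AdmQ W K p)) (μ : Bool), Module.Finite (ZMod p) (Mix m n μ)) →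
      (∀ (m : Finset {ℓ // Zhang2014.IsKolyvaginPrime (W.conductorNorm ℤ) W K p ℓ}) (ℓ : {ℓ // Zhang2014.IsKolyvaginPrime (W.conductorNorm ℤ) W K p ℓ}) (n : Finset (AdmQ W K p)) (μ : Bool), ℓ ∉ m → n.Nonempty →
        (∃ x ∈ Mix m n μ, ¬ (∀ v : HeightOneSpectrum (𝓞 K), ((ℓ : ℕ) : 𝓞 K) ∈ v.asIdeal → x ∈ (W.baseChange K).torsionLocalKer (v.adicCompletion K) ((p ^ 1 : ℕ) : ℤ))) →
        (∀ y, y ∈ Mix (insert ℓ m) n μ ↔ (y ∈ Mix m n μ ∧ (∀ v : HeightOneSpectrum (𝓞 K), ((ℓ : ℕ) : 𝓞 K) ∈ v.asIdeal → y ∈ (W.baseChange K).torsionLocalKer (v.adicCompletion K) ((p ^ 1 : ℕ) : ℤ)))) ∧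
          finrank (ZMod p) (Mix (insert ℓ m) n μ) + 1 = finrank (ZMod p) (Mix m n μ)) ∧
      (∀ (m : Finset {ℓ // Zhang2014.IsKolyvaginPrime (W.conductorNorm ℤ) W K p ℓ}) (ℓ : {ℓ // Zhang2014.IsKolyvaginPrime (W.conductorNorm ℤ) W K p ℓ}) (n : Finset (AdmQ W K p)) (μ : Bool), ℓ ∉ m → n.Nonempty →
        (∃ y ∈ Mix (insert ℓ m) n μ, ¬ (∀ v : HeightOneSpectrum (𝓞 K), ((ℓ : ℕ) : 𝓞 K) ∈ v.asIdeal → y ∈ (W.baseChange K).torsionLocalKer (v.adicCompletion K) ((p ^ 1 : ℕ) : ℤ))) →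
        (∀ x, x ∈ Mix m n μ ↔ (x ∈ Mix (insert ℓ m) n μ ∧ (∀ v : HeightOneSpectrum (𝓞 K), ((ℓ : ℕ) : 𝓞 K) ∈ v.asIdeal → x ∈ (W.baseChange K).torsionLocalKer (v.adicCompletion K) ((p ^ 1 : ℕ) : ℤ)))) ∧
          finrank (ZMod p) (Mix m n μ) + 1 = finrank (ZMod p) (Mix (insert ℓ m) n μ)) ∧
      (∀ (m : Finset {ℓ // Zhang2014.IsKolyvaginPrime (W.conductorNorm ℤ) W K p ℓ}) (ℓ : {ℓ // Zhang2014.IsKolyvaginPrime (W.conductorNorm ℤ) W K p ℓ}) (n : Finset (AdmQ W K p)) (μ : Bool), ℓ ∉ m → n.Nonempty →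
        (∃ x ∈ Mix m n μ, ¬ (∀ v : HeightOneSpectrum (𝓞 K), ((ℓ : ℕ) : 𝓞 K) ∈ v.asIdeal → x ∈ (W.baseChange K).torsionLocalKer (v.adicCompletion K) ((p ^ 1 : ℕ) : ℤ))) ∨ (∃ y ∈ Mix (insert ℓ m) n μ, ¬ (∀ v : HeightOneSpectrum (𝓞 K), ((ℓ : ℕ) : 𝓞 K) ∈ v.asIdeal → y ∈ (W.baseChange K).torsionLocalKer (v.adicCompletion K) ((p ^ 1 : ℕ) : ℤ))))))
    (W : WeierstrassCurve ℚ) [W.IsElliptic] [W.IsGloballyMinimal] [NeZero (W.conductorNorm ℤ)]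
    (p : ℕ) [Fact p.Prime] (K : Type) [Field K] [NumberField K]
    (Dt : ModularParametrizationData W (W.conductorNorm ℤ)) (β : ℤ) (ι : K →+* ℂ)
    (hp : 5 ≤ p) (hadd : Addv W p) (hs : W.HasSurjectiveModNGaloisRep p)
    (hsp : ∀ (ℓ : ℕ) [Fact ℓ.Prime], W.HasMultiplicativeReductionAtPrime ℓ → ¬ p ∣ padicValInt ℓ W.minimalDiscriminantInt)
    (htwo : ∃ (ℓ₁ ℓ₂ : ℕ) (_ : Fact ℓ₁.Prime) (_ : Fact ℓ₂.Prime), ℓ₁ ≠ ℓ₂ ∧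
      W.HasMultiplicativeReductionAtPrime ℓ₁ ∧ W.HasMultiplicativeReductionAtPrime ℓ₂)
    (htam : ¬ p ∣ W.tamagawaProduct) (hr : W.analyticRank = 1) (hK : IsImaginaryQuadratic K) (hodd : Odd (NumberField.discr K))
    (hlt : NumberField.discr K < -4) (hH : SatisfiesHeegnerHypothesis (W.conductorNorm ℤ) K)
    (hL : (W.quadraticTwist (NumberField.discr K : ℚ)).entireLFunction 1 ≠ 0)
    (hβ : (4 * (W.conductorNorm ℤ : ℤ)) ∣ β ^ 2 - NumberField.discr K) (hc : ¬ (p : ℤ) ∣ Dt.c)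
    (hav : ∃ (W₀ : WeierstrassCurve ℚ) (_ : W₀.IsElliptic) (_ : W₀.IsGloballyMinimal) (_ : NeZero (W₀.conductorNorm ℤ))
      (Dt₀ : ModularParametrizationData W₀ (W₀.conductorNorm ℤ)) (e : geomTorsion W (p : ℤ) ≃+ geomTorsion W₀ (p : ℤ)),
      (∀ (σ : absoluteGaloisGroup ℚ) (P : geomTorsion W (p : ℤ)), e (σ • P) = σ • e P) ∧
      W₀.HasGoodReductionAtPrime p ∧ ¬ (p : ℤ) ∣ W₀.frobeniusTrace p - 1 ∧
      (∀ (ℓ : ℕ) [Fact ℓ.Prime], W₀.HasMultiplicativeReductionAtPrime ℓ →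
        ¬ p ∣ padicValInt ℓ W₀.minimalDiscriminantInt) ∧
      (∀ q : ℕ, q.Prime → (q ∣ p * W.conductorNorm ℤ ↔ q ∣ p * W₀.conductorNorm ℤ)) ∧
      (∀ (ℓ : ℕ) [Fact ℓ.Prime], W.HasMultiplicativeReductionAtPrime ℓ ↔ W₀.HasMultiplicativeReductionAtPrime ℓ) ∧
      SatisfiesHeegnerHypothesis (W₀.conductorNorm ℤ) K ∧ ¬ (p : ℤ) ∣ Dt₀.c ∧
      ∃ (ιp : K →+* ℚ_[p]) (H₀ : HeegnerDatum (W₀.conductorNorm ℤ) (NumberField.discr K))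
        (y₀ : (W₀.baseChange K).toAffine.Point),
        WeierstrassCurve.Affine.Point.map ι.toRatAlgHom y₀ = heegnerPointComplex Dt₀ H₀ ∧
          ¬ ∃ Q : (W₀.baseChange ℚ_[p]).toAffine.Point, (p : ℤ) • Q = X11b.padicPointOf W₀ p ιp y₀) :
    ∀ (c : K ≃ₐ[ℚ] K), c ≠ 1 → ∀ [Module (ZMod p) (Vp W K p)], Nonempty (LevelKolyvaginSystemP W K p Dt β ι c) := by
  intro c hc1 _
  obtain ⟨W₀, _, _, _, Dt₀, e, he, hgood₀, hna, hsp₀, hrad, htype, hH₀, hc₀, ιp, hcert⟩ := hav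
  -- sign agreement at the multiplicative primes is automatic (Tate curve + torsion congruence)
  have hsign : ∀ (ℓ : ℕ) [Fact ℓ.Prime], W₀.HasMultiplicativeReductionAtPrime ℓ → W.LFunction ℓ = W₀.LFunction ℓ :=
    sign_agreement_of_torsionCongr W W₀ p hp hadd hsp₀ htype e he
  -- the SEED: KPA′ at this frame, by Kriz–Li (conductor one)
  obtain ⟨n, d, hsupp, hd⟩ := kolyvaginPrimitiveAdditive_conclusion_on_gammaLocus W p K Dt β ι hKL hp hadd hs hK hlt hH hβ hc
    W₀ e he hgood₀ hna hrad htype hsign Dt₀ hc₀ hH₀ ιp hcert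
  obtain ⟨m, hm⟩ := exists_finset_prod_eq_of_kolSupp hsupp
  have seed : ∃ (m : Finset {ℓ // Zhang2014.IsKolyvaginPrime (W.conductorNorm ℤ) W K p ℓ}) (d : KolyvaginHeegnerData Dt β ι (∏ ℓ ∈ m, (ℓ : ℕ))),
      d.kolyvaginClass (Fact.out : p.Prime) 1 ≠ 0 := ⟨m, by rw [hm]; exact ⟨d, hd⟩⟩
  -- the mixed spaces of `E` itself and the twin dichotomy for them
  obtain ⟨Mix, hMix, hfin⟩ := exists_mixedSpaces W K p c ι
  obtain ⟨hDrop, hRise, hJump⟩ := hTwin W p K c ι hp hs hK hlt hc1 (hDual.2 K) Mix hMix hfin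
  exact nonempty_levelKolyvaginSystemP_of_seed_of_twin W K p c ι Dt β hK hp hs hc1 hH hβ (hDual.2 K)
    (odd_finrank_selQP_empty_of_published W K p c Dt β ι hPUB hDual hp hadd hs hsp htwo htam hr hK hodd hH hL hβ hc)
    Mix hMix hfin hDrop hRise hJump seed

end Summit.BirchSwinnertonDyer.BirchSwinnertonDyer.Theorems.AdditiveKoly

end
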